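import Literature.MathematicalPhysics.QuantumFieldTheory.Balaban1983to89.Beta.DriftRemainder
import Literature.MathematicalPhysics.QuantumFieldTheory.Balaban1983to89.Beta.OneStepKernelFamily

/-!
# Beta / RemainderThresholdSharp — BINDER-OWNERS row D4: the (D4) binder pair of the wall's END is LOAD-BEARING and its
# numeric threshold is SHARP (β sub-cell, lineage `b2b-balaban-beta-an4` = OWNER of row D4 «RemainderConst leaves for
# Balaban's split»; generation 30, the lineage's second PROVER seat)

HONEST FRAMING (page 1 of everything the β sub-cell writes): discharging `BetaPertH` makes Bałaban's UV stability
UNCONDITIONAL — a real constructive-QFT result; it is NOT the continuum limit and NOT the Clay problem.  HONEST DEPENDENCY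
(cell reorg 2026-08-19, verbatim): «continuum YM on T⁴ ⇐ BetaPertH ∧ nine spine estimates (0/9 proved); BetaPertH ⇐ (D1) ∧
(D4) ∧ CAP+tail; G-an2-4 gates asym, D1 and NE2/3/4.»  THIS MODULE INSTANTIATES NO BINDER AND SAYS NOTHING ABOUT BAŁABAN'S
β-FUNCTIONS: it is a TIGHTNESS fact about the typed END statements of the wall, of the same kind as
`FlowStepRuns.sign_not_necessary` and `DriftRemainder.Witness.not_af1`.

ABSOLUTE RULE (cell charter, verbatim): "No internally-minted statement may enter as a cited fact. Every hypothesis is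
either kernel-proved in this package or a verbatim quotation of a PUBLISHED theorem with page reference. The manuscript(s)
under audit are NOT citable for their own disputed steps — they are the thing under adjudication; programme-internal
(2001/route/tribunal) claims are never citable."  Nothing is cited in this file; every declaration is a definition or a
theorem proved from the UNMODIFIED Literature modules `Beta.DriftRemainder`, `Beta.Drift`, `Beta.RemainderChain`,
`FlowStepRuns`, `DagBinding`, `B12Normalization`, `Beta.OneStepKernelFamily` (imported BY NAME).

## What row D4 is, and what this file adds

Row D4 of `HOME/BINDER-OWNERS.md` = the binder pair `(hrem : RemainderConst Sβ γ₀ rr) (hr : rr ≤ B12Normalization.stepBal N Lc)`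
of the wall's END `OneStepKernelFamily.endpointExistence_of_D1Drift` (equivalently of an4's
`DriftRemainder.endpointExistence_of_drift_remainderConst_cont`: `OneLoopDrift b A S.β0 → RemainderConst S γ₀ r → r ≤ b →
BetaContH γ₀ β → EndpointExistence C` for forward-generated `C`).  The typed REDUCTION of the pair to Bałaban's printed
chain is kernel-complete (22 an4 modules, END `RemainderDecay190.ChainTFac190.abs_beta1_le`); its DISCHARGE for Bałaban's
objects has no date (`BETA/REMAINDER-BETA.md` §8–§9).  The restriction `hr` is row D4's numeric side condition N3 — «the ONE
extra restriction of printed type the constant form costs» (`REMAINDER-BETA.md` §2/§3): it is met by choosing ε₁ small AFTER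
κ, A₂ and BEFORE γ (`RemainderChainKP.exists_eps1_lt_and_le`).  This file answers, in the kernel, the two Edisonian
questions a referee asks of such a binder pair:

(Q1) IS `hrem`/`hr` IDLE?  Could the END hold with `hr` relaxed to `rr ≤ b + δ` for some δ > 0, or with `hrem` dropped?
     **NO** (§3–§4): for EVERY one-loop coefficient sequence `c` with `OneLoopDrift b A c` (`b ≥ 0`; in the wall
     `b = stepBal N Lc` and `c` = the family pinned by row D1's identification binder `hβ`) and EVERY `δ > 0` the continuous
     history family `β_{k+1}(g_0,…,g_k) := c_k − (b+δ)·min{1, (k+1)·g_k}` has the printed one-loop split with `β⁰ = c`, a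
     (2.14)-vanishing remainder in the CONSTANT form `RemainderConst S γ₀ (b + δ)` for every `γ₀`, and its canonical
     forward-generated construction `FlowStepRuns.modelOf β` VIOLATES `DagBinding.EndpointExistence`
     (`not_endpointExistence_of_lt`).  With the same family, `EndpointExistence (modelOf (betaG c rr)) ↔ rr ≤ b` for
     `0 ≤ rr` (`endpointExistence_iff`): the constant `b` in `hr : r ≤ b` is EXACTLY the sharp threshold, whatever the drift
     defect `A`.  Packaged over the END's own binder list: `END_false_with_relaxed_threshold` (the END with `r ≤ b` weakened
     to `r ≤ b + δ` is false for every `b ≥ 0`, `δ > 0`), and in the wall's letters (`D1Drift Lc Js N μ ν`,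
     `hβ : ∀ j, Sβ.β0 j = secondMoment (TbalOf Lc Js j) μ ν`, `rr := stepBal N Lc + δ`): `wall_threshold_sharp`.
(Q2) WHAT IS `hr` THE PRICE OF?  Of the CONSTANT (ε₁-)form of the remainder that [Balaban1988RG2Cluster] (2.41) prints.
     Under the LINEAR form (AF-1) `|β¹_{k+1}| ≤ C·g_k` — [II] p. 8's unexecuted alternative «use the expression g_k|B|
     instead of ε₁» — NO numeric restriction at all is needed: `endpointExistence_of_drift_af1` holds for EVERY Lipschitz
     constant `C` (shrink γ; `EndpointExistence` quantifies `∃ γ₂` itself).  The sharpness witness of (Q1) is accordingly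
     NOT (AF-1) for any constant (`splitG_not_af1`, = an4's `DriftRemainder.Witness.not_af1`): the failure mode lives exactly
     in the gap between the printed ε₁-form and the unprinted g_k-form.

MECHANISM of (Q1): along an in-interval run of `modelOf β` ending at `g_K = g`, (0.20) holds (`FlowStepRuns.rgEqH_of_inInterval`):
`1/g_j² = 1/g_{j+1}² + c_j − rr·min{1,(j+1)g_j}`; on the scales `j ≥ J₀ := ⌈1/g² + 4A + b⌉₊` the regime `(j+1)g_j < 1` is impossible
(it would force `1/g_j² > (j+1)² ≥ j+1 > 1/g² + 4A + b ≥ 1/g_j²`, by the window sums of `c` and `|c_j − b| ≤ 2A`), so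
`1/g_{J₀}² ≤ 1/g² + 2A − (rr−b)(K − J₀) < 0` once `K ≥ J₀ + ⌈(1/g² + 2A)/(rr−b)⌉₊ + 1`; `EndpointExistence` asks a run for EVERY `K`.

NOT CLAIMED.  Nothing about Bałaban's `β¹_{k+1}` (whose constant-form bound `ε₁·K_rem` is row D4's typed chain and whose g_k-form is
unprinted); nothing of `BetaPertH`; NOT continuum, NOT Clay, NOT summit progress.  Value = a kernel certificate for the row's Edisonian
census (`BETA/REMAINDER-BETA.md` v3.3 §10): the variant «relax / drop N3» is REFUTED, and N3 is the exact price of the printed ε₁-form.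
-/

namespace Summit.QuantumFields.BalabanUV.Beta.RemainderThresholdSharp

open Literature.MathematicalPhysics.QuantumFieldTheory.Balaban1983to89
open Literature.MathematicalPhysics.QuantumFieldTheory.Balaban1983to89.Beta
open FlowStep FlowStepRuns DagBinding
open Beta.Drift (OneLoopDrift abs_sum_Ico_sub_le_of_drift)
open Beta.RemainderChain (RemainderConst remainderConst_of_af1)
open Beta.DriftRemainder (abs_beta0_sub_le_of_drift endpointExistence_of_drift_remainderConst_cont)

noncomputable section

/-! ## §1 The family `β_{k+1}(g_0,…,g_k) = c_k − rr·min{1,(k+1)·g_k}` over ARBITRARY one-loop data `c` -/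

/-- The test family over one-loop data `c : ℕ → ℝ` and a remainder size `rr`:
`β_{k+1}(g_0,…,g_k) := c_k − rr·min{1, (k+1)·g_k}` (an4's `DriftRemainder.Witness.betaW b rr` is the case `c ≡ b`). [folklore] -/
def betaG (c : ℕ → ℝ) (rr : ℝ) : HBeta := fun k p => c k - rr * min 1 (((k : ℝ) + 1) * p (Fin.last k))

/-- Its printed one-loop split: `β⁰ := c`, `β¹_{k+1}(p) := −rr·min{1,(k+1)p_k}` — vanishing at `p_k = 0` as (2.14) requires. [folklore] -/
def splitG (c : ℕ → ℝ) (rr : ℝ) : B12Beta.OneLoopSplit (betaG c rr) where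
  β0 := c
  β1 := fun k p => -(rr * min 1 (((k : ℝ) + 1) * p (Fin.last k)))
  split := fun k p => by simp only [betaG]; ring
  vanish := fun k p hp => by simp [hp]

/-- The one-loop part of the split IS the given data `c` (so a drift hypothesis on `c` is a drift hypothesis on `β⁰`). [folklore] -/
@[simp] theorem splitG_β0 (c : ℕ → ℝ) (rr : ℝ) : (splitG c rr).β0 = c := rfl

/-- At constant data the family is an4's separating witness `DriftRemainder.Witness.betaW` (definitionally). [folklore] -/
theorem betaG_const (b rr : ℝ) : betaG (fun _ => b) rr = DriftRemainder.Witness.betaW b rr := rfl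

/-- The remainder obeys the CONSTANT form `|β¹_{k+1}| ≤ rr` on every `]0,γ]`-box, all scales (`rr ≥ 0`). [folklore] -/
theorem remainderConst_splitG (c : ℕ → ℝ) {rr : ℝ} (hrr : 0 ≤ rr) (γ : ℝ) : RemainderConst (splitG c rr) γ rr := by
  intro k p hp
  have hpk : 0 < p (Fin.last k) := (hp (Fin.last k)).1
  have hm0 : 0 ≤ min 1 (((k : ℝ) + 1) * p (Fin.last k)) := le_min zero_le_one (by positivity)
  have hm1 : min 1 (((k : ℝ) + 1) * p (Fin.last k)) ≤ 1 := min_le_left _ _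
  show |-(rr * min 1 (((k : ℝ) + 1) * p (Fin.last k)))| ≤ rr
  rw [abs_neg, abs_of_nonneg (mul_nonneg hrr hm0)]
  nlinarith

/-- Conversely the constant form with a constant `r` FORCES `rr ≤ r` (test the history `p ≡ min γ 1` at a scale `k ≥ 1/min γ 1`),
so `rr` is the least constant-form bound of this remainder. [folklore] -/
theorem le_of_remainderConst_splitG {c : ℕ → ℝ} {rr r γ : ℝ} (hγ : 0 < γ) (hrr : 0 ≤ rr)
    (h : RemainderConst (splitG c rr) γ r) : rr ≤ r := by
  set t : ℝ := min γ 1 with ht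
  have ht0 : 0 < t := lt_min hγ one_pos
  obtain ⟨k, hk⟩ := exists_nat_ge (1 / t)
  have hkt : 1 ≤ ((k : ℝ) + 1) * t := by
    rw [div_le_iff₀ ht0] at hk
    nlinarith
  set p : Fin (k + 1) → ℝ := fun _ => t with hp
  have hpbox : p ∈ B12Beta.HistBox γ k := fun _ => ⟨ht0, min_le_left _ _⟩
  have hval := h k p hpbox
  have hmin : min 1 (((k : ℝ) + 1) * p (Fin.last k)) = 1 := min_eq_left hkt
  have : |(splitG c rr).β1 k p| = rr := by
    show |-(rr * min 1 (((k : ℝ) + 1) * p (Fin.last k)))| = rr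
    rw [hmin, mul_one, abs_neg, abs_of_nonneg hrr]
  rw [this] at hval
  exact hval

/-- So `rr` is the LEAST constant-form bound of the family's remainder on any non-empty box: no admissible constant below it
(in §4: the witness cannot meet `hr : r ≤ b` with ANY `r`, since its least bound is `b + δ`). [folklore] -/
theorem isLeast_remainderConst_splitG (c : ℕ → ℝ) {rr γ : ℝ} (hγ : 0 < γ) (hrr : 0 ≤ rr) :
    IsLeast {r : ℝ | RemainderConst (splitG c rr) γ r} rr :=
  ⟨remainderConst_splitG c hrr γ, fun _ hr => le_of_remainderConst_splitG hγ hrr hr⟩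

/-- Each `β_{k+1}` of the family is continuous (everywhere). [folklore] -/
theorem continuous_betaG (c : ℕ → ℝ) (rr : ℝ) (k : ℕ) : Continuous (betaG c rr k) := by
  unfold betaG
  fun_prop

/-- Hence the joint continuity binder (C) `BetaContH γ β` holds on every box. [folklore] -/
theorem betaContH_betaG (c : ℕ → ℝ) (rr γ : ℝ) : BetaContH γ (betaG c rr) :=
  fun k => (continuous_betaG c rr k).continuousOn

/-- The remainder of the family is NOT of the linear form (AF-1) for ANY k-uniform constant (`rr > 0`, `γ > 0`) — an4's
`DriftRemainder.Witness.not_af1` (the remainder does not depend on `c`). [folklore] -/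
theorem splitG_not_af1 (c : ℕ → ℝ) {rr γ : ℝ} (hrr : 0 < rr) (hγ : 0 < γ) :
    ¬ ∃ C : ℝ, ∀ k (p : Fin (k + 1) → ℝ), p ∈ B12Beta.HistBox γ k →
      |(splitG c rr).β1 k p| ≤ C * p (Fin.last k) :=
  DriftRemainder.Witness.not_af1 (b := 0) hrr hγ

/-! ## §2 At or below the threshold the END applies (the positive side, an4's `DriftRemainder` by name) -/

/-- `rr ≤ b`: every END of the drift road applies to the family — e.g. `EndpointExistence (modelOf (betaG c rr))` from
`OneLoopDrift b A c`, by `DriftRemainder.endpointExistence_of_drift_remainderConst_cont` (drift + constant form + `rr ≤ b` +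
continuity; upper bound derived). [folklore] -/
theorem endpointExistence_of_le {c : ℕ → ℝ} {b A rr : ℝ} (hdrift : OneLoopDrift b A c) (hrr : 0 ≤ rr) (hle : rr ≤ b) :
    EndpointExistence (modelOf (betaG c rr)) :=
  endpointExistence_of_drift_remainderConst_cont (modelOf_forwardGenerated _) (splitG c rr) one_pos
    (by simpa using hdrift) (remainderConst_splitG c hrr 1) hle (betaContH_betaG c rr 1)

/-! ## §3 Above the threshold NO run exists on long flows (the negative side) -/

/-- **THE FORCING LEMMA.**  For one-loop data drifting with slope `b ≥ 0` and defect `A`, a remainder size `rr > b`, and a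
POSITIVE solution `g` of the history recursion (0.20) for `betaG c rr` up to `K` (no box needed: positivity suffices): if
`K ≥ ⌈1/g_K² + 4A + b⌉₊ + ⌈(1/g_K² + 2A)/(rr − b)⌉₊ + 1` — contradiction.  (On the last `K − J₀` scales, `J₀ := ⌈1/g_K² + 4A + b⌉₊`,
every step is in the regime `(j+1)·g_j ≥ 1`, so `1/g_{J₀}² = 1/g_K² + Σ_{[J₀,K)} c − rr(K − J₀) ≤ 1/g_K² + 2A − (rr−b)(K−J₀) < 0`.)
[folklore] -/
theorem no_long_positive_run {c : ℕ → ℝ} {b A rr : ℝ} (hb : 0 ≤ b) (hdrift : OneLoopDrift b A c) (hrr : b < rr)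
    {K : ℕ} {g : ℕ → ℝ} (hrg : RGEqH K (betaG c rr) g) (hpos : ∀ k, k ≤ K → 0 < g k)
    (hK : ⌈1 / (g K) ^ 2 + 4 * A + b⌉₊ + (⌈(1 / (g K) ^ 2 + 2 * A) / (rr - b)⌉₊ + 1) ≤ K) : False := by
  have hA : 0 ≤ A := hdrift.nonneg
  have hgK : 0 < g K := hpos K le_rfl
  set δ : ℝ := rr - b with hδ_def
  have hδ : 0 < δ := sub_pos.mpr hrr
  have hrr0 : 0 ≤ rr := hb.trans hrr.le
  set M₁ : ℝ := 1 / (g K) ^ 2 + 4 * A + b with hM₁_def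
  set J₀ : ℕ := ⌈M₁⌉₊ with hJ₀_def
  set N₁ : ℕ := ⌈(1 / (g K) ^ 2 + 2 * A) / δ⌉₊ + 1 with hN₁_def
  have hJK : J₀ + N₁ ≤ K := hK
  -- the step equation (0.20) for the family
  have hstep : ∀ j, j < K →
      1 / (g j) ^ 2 = 1 / (g (j + 1)) ^ 2 + (c j - rr * min 1 (((j : ℝ) + 1) * g j)) := by
    intro j hj
    have h := hrg j hj
    simpa only [betaG, prefixOf_apply, Fin.val_last] using h
  -- pointwise and window bounds on the one-loop data
  have hcpt : ∀ j, c j ≤ b + 2 * A := fun j => by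
    have := (abs_le.mp (abs_beta0_sub_le_of_drift hdrift j)).2
    linarith
  have hwin : ∀ k n : ℕ, k ≤ n → ∑ i ∈ Finset.Ico k n, c i ≤ b * ((n : ℝ) - k) + 2 * A := fun k n hkn => by
    have := (abs_le.mp (abs_sum_Ico_sub_le_of_drift hdrift hkn)).2
    linarith
  -- downward induction over the last scales: all in the regime `(j+1) g_j ≥ 1`, with the exact telescoped value
  have key : ∀ n : ℕ, n ≤ K - J₀ →
      1 / (g (K - n)) ^ 2 = 1 / (g K) ^ 2 + ∑ i ∈ Finset.Ico (K - n) K, c i - rr * n := by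
    intro n
    induction n with
    | zero => intro _; simp
    | succ n ih =>
      intro hn
      have ihn := ih ((Nat.le_succ n).trans hn)
      have hnK : n + 1 ≤ K := hn.trans (Nat.sub_le K J₀)
      set j : ℕ := K - (n + 1) with hj_def
      have hj1 : j + 1 = K - n := by omega
      have hjK : j < K := by omega
      have hjJ : J₀ ≤ j := by omega
      -- the value one scale later is at most 1/g_K² + 2A
      have hy1 : 1 / (g (j + 1)) ^ 2 ≤ 1 / (g K) ^ 2 + 2 * A := by
        rw [hj1, ihn]
        have hw := hwin (K - n) K (Nat.sub_le K n)
        have hcast : ((K : ℝ) - ((K - n : ℕ) : ℝ)) = n := by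
          rw [Nat.cast_sub (by omega)]; ring
        rw [hcast] at hw
        have hbn : b * (n : ℝ) ≤ rr * n := mul_le_mul_of_nonneg_right hrr.le (Nat.cast_nonneg n)
        linarith
      have hgj : 0 < g j := hpos j hjK.le
      have hsj := hstep j hjK
      -- the regime `(j+1) g_j < 1` is impossible at scales j ≥ J₀
      have hreg : 1 ≤ ((j : ℝ) + 1) * g j := by
        by_contra hlt
        push Not at hlt
        have hprod_nonneg : 0 ≤ ((j : ℝ) + 1) * g j := by positivity
        have hmin : min 1 (((j : ℝ) + 1) * g j) = ((j : ℝ) + 1) * g j := min_eq_right hlt.le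
        have hyj_le : 1 / (g j) ^ 2 ≤ M₁ := by
          rw [hsj, hmin]
          have hc := hcpt j
          have hr' : 0 ≤ rr * (((j : ℝ) + 1) * g j) := mul_nonneg hrr0 hprod_nonneg
          have : M₁ = 1 / (g K) ^ 2 + 4 * A + b := rfl
          linarith
        have hyj_gt : ((j : ℝ) + 1) ^ 2 < 1 / (g j) ^ 2 := by
          rw [lt_div_iff₀ (pow_pos hgj 2)]
          have h1 : (((j : ℝ) + 1) * g j) ^ 2 < 1 := by nlinarith
          calc ((j : ℝ) + 1) ^ 2 * (g j) ^ 2 = (((j : ℝ) + 1) * g j) ^ 2 := by ring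
            _ < 1 := h1
        have hjM : M₁ ≤ (j : ℝ) := (Nat.le_ceil M₁).trans (by exact_mod_cast hjJ)
        have hsq : (j : ℝ) + 1 ≤ ((j : ℝ) + 1) ^ 2 := by nlinarith [(Nat.cast_nonneg j : (0 : ℝ) ≤ j)]
        linarith
      have hmin1 : min 1 (((j : ℝ) + 1) * g j) = 1 := min_eq_left hreg
      rw [hsj, hmin1, hj1, ihn, Finset.sum_eq_sum_Ico_succ_bot hjK, hj1]
      push_cast
      ring
  -- read the telescoped value at the first of those scales
  have hJ₀K : J₀ ≤ K := le_trans (Nat.le_add_right J₀ N₁) hJK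
  have hfin := key (K - J₀) le_rfl
  have hKJ : K - (K - J₀) = J₀ := Nat.sub_sub_self hJ₀K
  rw [hKJ] at hfin
  have hposJ : 0 < 1 / (g J₀) ^ 2 := by
    have := hpos J₀ hJ₀K
    positivity
  have hw := hwin J₀ K hJ₀K
  set t : ℝ := ((K - J₀ : ℕ) : ℝ) with ht_def
  have hcast : ((K : ℝ) - (J₀ : ℝ)) = t := by rw [ht_def, Nat.cast_sub hJ₀K]
  rw [hcast] at hw
  have hsplit : rr * t = b * t + δ * t := by rw [hδ_def]; ring
  have htN : (N₁ : ℝ) ≤ t := by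
    rw [ht_def]; exact_mod_cast (show N₁ ≤ K - J₀ by omega)
  have hδt : δ * (N₁ : ℝ) ≤ δ * t := mul_le_mul_of_nonneg_left htN hδ.le
  have hceil : (1 / (g K) ^ 2 + 2 * A) / δ ≤ (⌈(1 / (g K) ^ 2 + 2 * A) / δ⌉₊ : ℝ) := Nat.le_ceil _
  have hN₁val : (N₁ : ℝ) = (⌈(1 / (g K) ^ 2 + 2 * A) / δ⌉₊ : ℝ) + 1 := by
    rw [hN₁_def]; push_cast; ring
  have hδN : 1 / (g K) ^ 2 + 2 * A + δ ≤ δ * (N₁ : ℝ) := by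
    rw [hN₁val, mul_add, mul_one]
    rw [div_le_iff₀ hδ] at hceil
    linarith
  linarith

/-- **ABOVE THE THRESHOLD THE END FAILS**: for one-loop data `c` with `OneLoopDrift b A c` (`b ≥ 0`) and a remainder size
`rr > b`, the canonical forward-generated construction of `β_{k+1} = c_k − rr·min{1,(k+1)g_k}` does NOT satisfy
`DagBinding.EndpointExistence`: for the torus exponent `m = 0`, whatever `γ₂` and `g⋆` are offered, at `g := g⋆` and
`K := ⌈1/g⋆² + 4A + b⌉₊ + ⌈(1/g⋆² + 2A)/(rr − b)⌉₊ + 1` no bare coupling yields an in-interval run ending at `g_K = g⋆`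
(`no_long_positive_run` on the run, which solves (0.20) by `FlowStepRuns.rgEqH_of_inInterval`). [folklore] -/
theorem not_endpointExistence_of_lt {c : ℕ → ℝ} {b A rr : ℝ} (hb : 0 ≤ b) (hdrift : OneLoopDrift b A c)
    (hrr : b < rr) : ¬ EndpointExistence (modelOf (betaG c rr)) := by
  intro h
  obtain ⟨γ₂, hγ₂, h2⟩ := h 0
  obtain ⟨gs, hgs, h3⟩ := h2 γ₂ hγ₂ le_rfl
  obtain ⟨g0, hI, hend⟩ :=
    h3 gs hgs le_rfl (⌈1 / gs ^ 2 + 4 * A + b⌉₊ + (⌈(1 / gs ^ 2 + 2 * A) / (rr - b)⌉₊ + 1))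
  set K : ℕ := ⌈1 / gs ^ 2 + 4 * A + b⌉₊ + (⌈(1 / gs ^ 2 + 2 * A) / (rr - b)⌉₊ + 1) with hK_def
  have hrg := rgEqH_of_inInterval (modelOf_forwardGenerated (betaG c rr)) (modelOf_haltsOutside (betaG c rr))
    (modelOf_curries (betaG c rr)) ⟨K, 0, g0⟩ hI
  have hpos : ∀ k, k ≤ K → 0 < (modelOf (betaG c rr) ⟨K, 0, g0⟩).flow.g k := fun k hk => (hI k hk).1
  refine no_long_positive_run hb hdrift hrr hrg hpos ?_
  have hend' : (modelOf (betaG c rr) ⟨K, 0, g0⟩).flow.g K = gs := hend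
  rw [hend']

/-! ## §4 SHARPNESS, packaged -/

/-- **THE THRESHOLD IS EXACTLY `b`** (iff form): for one-loop data with `OneLoopDrift b A c`, `b ≥ 0`, and a remainder size
`rr ≥ 0`, `EndpointExistence (modelOf (betaG c rr)) ↔ rr ≤ b` — independent of the drift defect `A`. [folklore] -/
theorem endpointExistence_iff {c : ℕ → ℝ} {b A rr : ℝ} (hb : 0 ≤ b) (hdrift : OneLoopDrift b A c) (hrr : 0 ≤ rr) :
    EndpointExistence (modelOf (betaG c rr)) ↔ rr ≤ b :=
  ⟨fun h => not_lt.mp fun hlt => not_endpointExistence_of_lt hb hdrift hlt h,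
    fun hle => endpointExistence_of_le hdrift hrr hle⟩

/-- **ROW D4'S BINDER PAIR IS LOAD-BEARING AND ITS THRESHOLD SHARP (END-hypothesis form).**  For EVERY one-loop coefficient
sequence `c` with `OneLoopDrift b A c` (`b ≥ 0`) and EVERY `δ > 0`, `γ₀`, there are a history family `β` and a printed split
`S` with `S.β0 = c` meeting every hypothesis of `DriftRemainder.endpointExistence_of_drift_remainderConst_cont` /
`OneStepKernelFamily.endpointExistence_of_D1Drift` for the canonical construction `modelOf β` (forward generation, halting,
currying, drift, continuity (C)) together with the CONSTANT-FORM remainder bound `RemainderConst S γ₀ (b + δ)` — i.e. `hr`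
violated by exactly `δ` (and `b + δ` is the LEAST constant-form bound of this remainder, `isLeast_remainderConst_splitG`, so NO
admissible `rr` meets `hr`) — and `¬ EndpointExistence (modelOf β)`.  So `hr : rr ≤ b` cannot be relaxed by any positive
amount, and `hrem` cannot be dropped (a fortiori). [folklore] -/
theorem d4_threshold_sharp {c : ℕ → ℝ} {b A : ℝ} (hb : 0 ≤ b) (hdrift : OneLoopDrift b A c) {δ : ℝ} (hδ : 0 < δ)
    (γ₀ : ℝ) :
    ∃ (β : HBeta) (S : B12Beta.OneLoopSplit β), S.β0 = c ∧ ForwardGenerated (modelOf β) β ∧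
      HaltsOutside (modelOf β) β ∧ CurriesHBeta (modelOf β) β ∧ OneLoopDrift b A S.β0 ∧
      RemainderConst S γ₀ (b + δ) ∧ BetaContH γ₀ β ∧ ¬ EndpointExistence (modelOf β) :=
  ⟨betaG c (b + δ), splitG c (b + δ), rfl, modelOf_forwardGenerated _, modelOf_haltsOutside _, modelOf_curries _,
    by simpa using hdrift, remainderConst_splitG c (by linarith) γ₀, betaContH_betaG c (b + δ) γ₀,
    not_endpointExistence_of_lt hb hdrift (by linarith)⟩

/-- **THE END WITH A RELAXED THRESHOLD IS FALSE.**  For every `b ≥ 0` and `δ > 0` the statement «for all forward-generated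
constructions `C` with history family `β`, split `S`, `0 < γ₀`, `OneLoopDrift b A S.β0`, `RemainderConst S γ₀ r`, **`r ≤ b + δ`**,
`BetaContH γ₀ β`: `EndpointExistence C`» — `DriftRemainder.endpointExistence_of_drift_remainderConst_cont` with `hr` weakened by
`δ` — is FALSE (witness: `d4_threshold_sharp` at the constant data `c ≡ b`, `A = 0`). [folklore] -/
theorem END_false_with_relaxed_threshold {b δ : ℝ} (hb : 0 ≤ b) (hδ : 0 < δ) :
    ¬ (∀ (C : B12.Construction) (β : HBeta) (_hgen : ForwardGenerated C β) (S : B12Beta.OneLoopSplit β)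
        (γ₀ A r : ℝ) (_hγ₀ : 0 < γ₀) (_hdrift : OneLoopDrift b A S.β0) (_hrem : RemainderConst S γ₀ r)
        (_hr : r ≤ b + δ) (_hcont : BetaContH γ₀ β), EndpointExistence C) := by
  intro h
  have hdrift : OneLoopDrift b 0 (fun _ : ℕ => b) := fun k => by
    simp only [Finset.sum_const, Finset.card_range, nsmul_eq_mul]
    rw [show (k : ℝ) * b - b * k = 0 by ring, abs_zero]
  obtain ⟨β, S, _, hgen, -, -, hdr, hrem, hcont, hnot⟩ := d4_threshold_sharp hb hdrift hδ 1
  exact hnot (h (modelOf β) β hgen S 1 0 (b + δ) one_pos hdr hrem le_rfl hcont)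

/- AT the threshold (`r ≤ b` exactly, any `A`) the END is TRUE: that is `DriftRemainder.endpointExistence_of_drift_remainderConst_cont`
itself (not restated here). -/

/-! ## §5 THE PRICE TAG: under the linear form (AF-1) NO numeric restriction is needed -/

/-- **(AF-1) WITH ANY CONSTANT SUFFICES.**  Drift `OneLoopDrift b A S.β0` with `b > 0`, the LINEAR remainder form
`|β¹_{k+1}(g_0,…,g_k)| ≤ C·g_k` on the `]0,γ₀]`-histories with an ARBITRARY constant `C ≥ 0`, and continuity (C) give
`EndpointExistence` for every forward-generated construction — NO relation between `C` and `b` is asked (contrast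
`Beta.Drift.endpointExistence_of_drift`, which takes `C·γ₀ ≤ b` and an upper bound): shrink the box to
`γ₁ := min γ₀ (b/(C+1))`, where the constant form holds with `r = C·γ₁ ≤ b` (`RemainderChain.remainderConst_of_af1`), and
apply the drift-road END (upper bound derived).  This is the kernel face of [Balaban1988RG2Cluster] p. 8's remark that the
g_k|B|-form «gives a better bound»: with it, row D4's restriction N3 would be void. [folklore] -/
theorem endpointExistence_of_drift_af1 {C : B12.Construction} {β : HBeta} (hgen : ForwardGenerated C β)
    (S : B12Beta.OneLoopSplit β) {γ₀ b A Cr : ℝ} (hγ₀ : 0 < γ₀) (hb : 0 < b) (hdrift : OneLoopDrift b A S.β0)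
    (hAF1 : ∀ k (p : Fin (k + 1) → ℝ), p ∈ B12Beta.HistBox γ₀ k → |S.β1 k p| ≤ Cr * p (Fin.last k))
    (hCr : 0 ≤ Cr) (hcont : BetaContH γ₀ β) : EndpointExistence C := by
  set γ₁ : ℝ := min γ₀ (b / (Cr + 1)) with hγ₁_def
  have hC1 : 0 < Cr + 1 := by linarith
  have hγ₁ : 0 < γ₁ := lt_min hγ₀ (div_pos hb hC1)
  have hγ₁₀ : γ₁ ≤ γ₀ := min_le_left _ _
  have hAF1' : ∀ k (p : Fin (k + 1) → ℝ), p ∈ B12Beta.HistBox γ₁ k → |S.β1 k p| ≤ Cr * p (Fin.last k) :=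
    fun k p hp => hAF1 k p fun i => ⟨(hp i).1, (hp i).2.trans hγ₁₀⟩
  have hrem : RemainderConst S γ₁ (Cr * γ₁) := remainderConst_of_af1 S hCr hAF1'
  have hr : Cr * γ₁ ≤ b := by
    have h1 : Cr * γ₁ ≤ Cr * (b / (Cr + 1)) := mul_le_mul_of_nonneg_left (min_le_right _ _) hCr
    have h2 : Cr * (b / (Cr + 1)) ≤ b := by
      rw [mul_div_assoc']
      rw [div_le_iff₀ hC1]
      nlinarith
    exact h1.trans h2
  have hcont' : BetaContH γ₁ β := fun k => (hcont k).mono (box_mono hγ₁₀ k)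
  exact endpointExistence_of_drift_remainderConst_cont hgen S hγ₁ hdrift hrem hr hcont'

/-! ## §6 IN THE WALL'S LETTERS (`OneStepKernelFamily`: `D1Drift`, `hβ`, `rr := stepBal N Lc + δ`) -/

section Wall

open Beta.OneStepKernelFamily (TbalOf D1Drift)
open B12Beta (secondMoment)
open Beta.OneStepResolventKernel (JetData)

/-- The one-loop step in Bałaban's units is non-negative for every block size `L ≥ 1`:
`0 ≤ stepBal N L = (11N²/12π²)·log L`. [folklore] -/
theorem stepBal_nonneg (N : ℝ) {L : ℝ} (hL : 1 ≤ L) : 0 ≤ B12Normalization.stepBal N L := by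
  rw [B12Normalization.stepBal_eq]
  exact mul_nonneg (by positivity) (Real.log_nonneg hL)

variable {Lc : ℕ} [NeZero Lc]

/-- **THE WALL'S (D4) RESTRICTION `rr ≤ stepBal N Lc` IS SHARP.**  Let `Js` be ANY step jet data with the wall statement
`D1Drift Lc Js N μ ν` (row D1 / EXIT-A: the one-loop coefficients `secondMoment (TbalOf Lc Js j) μ ν` drift with slope
`stepBal N Lc`).  For every `δ > 0` and `γ₀` there are a history family `β` and a split `Sβ` with the identification binder
`hβ : ∀ j, Sβ.β0 j = secondMoment (TbalOf Lc Js j) μ ν` LITERALLY, forward generation of `modelOf β`, continuity (C), and the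
constant-form remainder bound with `rr := stepBal N Lc + δ` — every binder of `OneStepKernelFamily.endpointExistence_of_D1Drift`
except `hr`, which fails by exactly `δ` — and `¬ EndpointExistence (modelOf β)`.  Nothing here concerns Bałaban's jets or
β-functions; it certifies that in the wall's END the (D4) pair is not idle and its constant not improvable. [folklore] -/
theorem wall_threshold_sharp (Js : ℕ → JetData 3 Lc) {N : ℝ} {μ ν : Fin 4} (hD : D1Drift Lc Js N μ ν) {δ : ℝ}
    (hδ : 0 < δ) (γ₀ : ℝ) :
    ∃ (β : HBeta) (Sβ : B12Beta.OneLoopSplit β), (∀ j, Sβ.β0 j = secondMoment (TbalOf Lc Js j) μ ν) ∧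
      ForwardGenerated (modelOf β) β ∧ BetaContH γ₀ β ∧
      RemainderConst Sβ γ₀ (B12Normalization.stepBal N Lc + δ) ∧ ¬ EndpointExistence (modelOf β) := by
  obtain ⟨A, hA⟩ := hD
  have hLc : (1 : ℝ) ≤ (Lc : ℝ) := by exact_mod_cast Nat.one_le_iff_ne_zero.mpr (NeZero.ne Lc)
  have hb : 0 ≤ B12Normalization.stepBal N Lc := stepBal_nonneg N hLc
  obtain ⟨β, S, hS, hgen, -, -, -, hrem, hcont, hnot⟩ := d4_threshold_sharp hb hA hδ γ₀
  exact ⟨β, S, fun j => by rw [hS], hgen, hcont, hrem, hnot⟩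

/- AT the wall's threshold (`rr ≤ stepBal N Lc`) the END holds: `OneStepKernelFamily.endpointExistence_of_D1Drift` itself. -/

end Wall

end

end Summit.QuantumFields.BalabanUV.Beta.RemainderThresholdSharp
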